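import Summits.QuantumAdvantage.QuantumAdvantage.Theses.CubicForrelation
import Summits.QuantumAdvantage.QuantumAdvantage.Theorems.NearExactIsExact.Negative.FlatPacking
import Summits.QuantumAdvantage.QuantumAdvantage.Theorems.NearExactIsExact.Negative.FlatPackingSixteenS
import Summits.QuantumAdvantage.QuantumAdvantage.Theorems.NearExactIsExact.Negative.FlatPackingSixteenV

/-!
# Flat-packing certificates at `n = 16` for `NearExactIsExact` (stmt-QuantumAdvantage-14043)

Negative-side support (B2b disprover seat `b2b-cforr-disprove-g9`, 2026-08-20).  HONEST FRAMING: CERTIFICATES (upper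
bounds on `max_f Φ(f,g)` over all cubic `f` for two explicit cubic `g`), not summit progress.

`gS = θ₉ ⊕ θ₂₇₃` and `gV = θ₁₂₉ ⊕ θ₂₇₃` (`FlatPackingSixteenS.lean`, `FlatPackingSixteenV.lean`) are Frobenius-invariant cubics on 16 bits whose
Walsh CAPACITY `2^{-24} Σ|W|` is `0.9453125` resp. `0.94140625 > 15/16` (`cap_gS`, `cap_gV`), so the capacity bound
alone (`forrelation_le_cap`) does not exclude a cubic partner with `Φ ∈ (15/16, 1)`.  Their weighted flat packings
(256 resp. 128 disjoint affine 4-flats in `supp W` with odd sign parity) pass the checker of `FlatPacking.lean`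
(`packCheck_gS`, `packCheck_gV`, `native_decide` — the file is `computational`), whence `Φ(f, gS), Φ(f, gV) ≤ 15/16`
for every cubic `f` (`forrelation_le_gS`, `forrelation_le_gV`, by `forrelation_le_of_packCheck`).  The records table of
this directory (`13/16, 7/8, 57/64, 57/64, 15/16, 15/16` at `n = 8, …, 18`) is unchanged.  `gS`, `gV` are the two
unit-coefficient members of the 16 orbit classes of cyclotomic binomials `Tr(a y^{d₁}) + Tr(β y^{d₂})` on `𝔽_{2¹⁶}`
(`wt d_i ∈ {2,3}`, not both `2`) with capacity `≥ 15/16` (capacities `0.9414 ×8`, `0.9453 ×3`, `0.9531 ×5`; none bent);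
all 16 are certified `≤ 15/16` by the same packing search (kit job `j078741`, sha256 manifest on the item), these two in
the kernel.  References: MacWilliams–Sloane 1977 Ch. 13, 15; Carlet 2021 §6.1; Aaronson–Ambainis 2018 §1.1.1.
-/

set_option linter.dupNamespace false -- D-0017: single-problem summit ⇒ `QuantumAdvantage.QuantumAdvantage` by design

namespace Summit.QuantumAdvantage.QuantumAdvantage.Theorems.NearExactIsExact.Negative.FlatPackingSixteen

open Finset
open Literature.Computability.QuantumComplexity
open Summit.QuantumAdvantage.QuantumAdvantage.Theorems.NearExactIsExact.Negative.SmallCases (wspec)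
open Summit.QuantumAdvantage.QuantumAdvantage.Theorems.NearExactIsExact.Negative.FlatPacking
  (packCheck capCheck cap_eq_of_capCheck forrelation_le_of_packCheck)
open Summit.QuantumAdvantage.QuantumAdvantage.Theorems.NearExactIsExact.Negative.FlatPackingSixteenS (gS certS isDegLeFun_gS)
open Summit.QuantumAdvantage.QuantumAdvantage.Theorems.NearExactIsExact.Negative.FlatPackingSixteenV (gV certV)

/-- The packing certificate of `gS` passes at `T = (15/16)·2²⁴`. [folklore] -/
theorem packCheck_gS : packCheck (8 + 8) gS 15728640 certS = true := by native_decide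

/-- The packing certificate of `gV` passes at `T = (15/16)·2²⁴`. [folklore] -/
theorem packCheck_gV : packCheck (8 + 8) gV 15728640 certV = true := by native_decide


/-- **Capacity of `gS`**: `Σ|W_gS| = 15859712 = 0.9453125·2²⁴ > (15/16)·2²⁴` — the capacity bound alone leaves the
window `(15/16, 0.9453…]` open for `gS`. [folklore] -/
theorem cap_gS : (∑ y ∈ range (2 ^ (8 + 8)), |wspec (8 + 8) gS y|) = 15859712 :=
  cap_eq_of_capCheck (by native_decide)

/-- **Capacity of `gV`**: `Σ|W_gV| = 15794176 = 0.94140625·2²⁴ > (15/16)·2²⁴`. [folklore] -/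
theorem cap_gV : (∑ y ∈ range (2 ^ (8 + 8)), |wspec (8 + 8) gV y|) = 15794176 :=
  cap_eq_of_capCheck (by native_decide)

/-- **`Φ(f, gS) ≤ 15/16` for every cubic `f` on 16 bits** (weighted flat packing, 256 flats). [folklore] -/
theorem forrelation_le_gS (f : (Fin (8 + 8) → Bool) → Bool) (hf : IsDegLeFun 3 f) :
    forrelation f gS ≤ 15 / 16 := by
  have h := forrelation_le_of_packCheck 8 packCheck_gS f hf
  norm_num at h
  linarith

/-- **`Φ(f, gV) ≤ 15/16` for every cubic `f` on 16 bits** (weighted flat packing, 128 flats). [folklore] -/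
theorem forrelation_le_gV (f : (Fin (8 + 8) → Bool) → Bool) (hf : IsDegLeFun 3 f) :
    forrelation f gV ≤ 15 / 16 := by
  have h := forrelation_le_of_packCheck 8 packCheck_gV f hf
  norm_num at h
  linarith

/-- **No cubic partner of `gS` or `gV` lands in the window `(15/16, 1)`.** [folklore] -/
theorem no_window_partner (f : (Fin (8 + 8) → Bool) → Bool) (hf : IsDegLeFun 3 f) :
    ¬ (15 / 16 < forrelation f gS) ∧ ¬ (15 / 16 < forrelation f gV) :=
  ⟨not_lt.mpr (forrelation_le_gS f hf), not_lt.mpr (forrelation_le_gV f hf)⟩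

/-- **A cubic `g` on 16 bits whose capacity exceeds `15/16` yet admits no cubic partner above `15/16`**: the capacity
bound is not the truth on the `f`-side. [folklore] -/
theorem exists_highcap_no_window :
    ∃ g : (Fin (8 + 8) → Bool) → Bool, IsDegLeFun 3 g ∧
      (15 : ℤ) * 2 ^ 20 < (∑ y ∈ range (2 ^ (8 + 8)), |wspec (8 + 8) g y|) ∧
      ∀ f : (Fin (8 + 8) → Bool) → Bool, IsDegLeFun 3 f → forrelation f g ≤ 15 / 16 :=
  ⟨gS, isDegLeFun_gS, by rw [cap_gS]; norm_num, forrelation_le_gS⟩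

end Summit.QuantumAdvantage.QuantumAdvantage.Theorems.NearExactIsExact.Negative.FlatPackingSixteen
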